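import Summits.KontsevichZagierPeriods.Zeta5Search.Barrier.ConeGammaLemmaFWinBox

/-!
# ζ(5) search — BARRIER: windowed Lemma F on BOXES — soundness, part 1: the hinge-sum form of the `J`-terms
# and the secant enclosures

HONEST FRAMING (cell `pub-zeta5`): systematic search; no irrationality claim unless kernel-certified. Theorems about the
REAL-VALUED expressions of `ConeGammaLemmaFWinBox` (hinge sums, `x log x`, feature tables); MODEL-side objects under
Brown–Zudilin's (28)+(30) ((28) observed, not proved) enter only through cert-2 g35's `winForm` in the sequel
`ConeGammaLemmaFWinBoxCert`. Nothing here is about any γ of record, the cone's sup, C2 (OPEN), S-E (CONJECTURED), (TD_A)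
or `ζ(5)`; records in print UNMOVED. Theory seat cert-2 g36 (item «WINDOWED LEMMA F ON BOXES — KERNEL»), part 2 (tables: `ConeGammaLemmaFWinBoxTables`).

* `harmR_succ`, `harmEnc_sound`; **`dG_eq_psiH_sub`** (`δ(a,b) = Ψ(a) − Ψ(b)`, cell induction on g35's `dG_cell` /
  `dG_split`); **`jT_eq_hinge`** (`jT x U = x log x + Ψ(U)·x − q_U(x)` for `x ≥ 0`, `U > 0`);
* `qH_eq_sum_hinge` (`q_U(x) = Σ_{k<K} (x/(k+1) − 1/U)₊`), **`le_qH_sub`** / **`qH_sub_le`** / **`qH_secant`** (the secant enclosure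
  `[H_⌊U·lo⌋, H_⌊U·hi⌋]`), **`mulLog_secant`** (`[1 + log lo, 1 + log hi]`, mean value theorem);
-/

open Finset Set MeasureTheory
open Literature.Analysis.ValidatedNumerics.NumericsMP

namespace Summit.KontsevichZagierPeriods.Zeta5Search.Barrier.ConeGamma

namespace LemmaFWinBox

open LemmaFBox (SC KT lnNat SC_pos coef featVal minNum maxNum sum8 box centre minNum_le le_maxNum)
open LemmaFWin (jT dG memShape memT memC winForm zI mem_zI dG_cell dG_split dG_symm jT_tail)

/-! ### Harmonic numbers and `Ψ` -/

/-- `H_0 = 0`. -/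
theorem harmR_zero : harmR 0 = 0 := by simp [harmR]

/-- `H_{n+1} = H_n + 1/(n+1)`. -/
theorem harmR_succ (n : ℕ) : harmR (n + 1) = harmR n + 1 / ((n : ℝ) + 1) := by
  simp [harmR, Finset.sum_range_succ]

/-- `H_n ≥ 0`. -/
theorem harmR_nonneg (n : ℕ) : 0 ≤ harmR n :=
  Finset.sum_nonneg fun k _ => by positivity

/-- `H` is monotone. -/
theorem harmR_mono {m n : ℕ} (h : m ≤ n) : harmR m ≤ harmR n := by
  unfold harmR
  exact Finset.sum_le_sum_of_subset_of_nonneg (Finset.range_mono h) fun k _ _ => by positivity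

/-- `harmEnc n` encloses `H_n`. -/
theorem harmEnc_sound : ∀ n : ℕ, MI.mem SC (harmR n) (harmEnc n)
  | 0 => by rw [harmR_zero]; exact mem_zI
  | n + 1 => by
    rw [harmR_succ]
    have h := MI.mem_ofFrac SC (1 : ℤ) (q := n + 1) (Nat.succ_pos n)
    have e : (((1 : ℤ) : ℝ)) / ((n + 1 : ℕ) : ℝ) = 1 / ((n : ℝ) + 1) := by push_cast; ring
    rw [e] at h
    exact MI.mem_add (harmEnc_sound n) h

/-- `Ψ` at a natural number: `Ψ(m) = H_m − 1` for `m ≥ 1`. -/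
theorem psiH_natCast {m : ℕ} (hm : 0 < m) : psiH (m : ℝ) = harmR m - 1 := by
  unfold psiH
  rw [Nat.floor_natCast]
  have : (m : ℝ) ≠ 0 := by exact_mod_cast hm.ne'
  rw [div_self this]

/-- **`δ(a,b) = Ψ(a) − Ψ(b)`** for `0 < a ≤ b` (induction over the integer cells, g35's `dG_cell` / `dG_split`). -/
theorem dG_eq_psiH_sub : ∀ (n : ℕ) {a b : ℝ}, 0 < a → a ≤ b → ⌊b⌋₊ ≤ ⌊a⌋₊ + n → dG a b = psiH a - psiH b
  | 0, a, b, ha, hab, hn => by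
    have hb : 0 < b := ha.trans_le hab
    have hmono : ⌊a⌋₊ ≤ ⌊b⌋₊ := Nat.floor_le_floor hab
    have heq : ⌊b⌋₊ = ⌊a⌋₊ := le_antisymm (by simpa using hn) hmono
    have h1 : ((⌊a⌋₊ : ℕ) : ℝ) ≤ a := Nat.floor_le ha.le
    have h2 : b ≤ (⌊a⌋₊ : ℝ) + 1 := by rw [← heq]; exact (Nat.lt_floor_add_one b).le
    rw [dG_cell ⌊a⌋₊ ha hab h1 h2]
    unfold psiH
    rw [heq]
    field_simp
    ring
  | n + 1, a, b, ha, hab, hn => by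
    by_cases hle : ⌊b⌋₊ ≤ ⌊a⌋₊ + n
    · exact dG_eq_psiH_sub n ha hab hle
    · have heq : ⌊b⌋₊ = ⌊a⌋₊ + (n + 1) := by omega
      set m := ⌊a⌋₊ with hm
      have hb : 0 < b := ha.trans_le hab
      have h1 : ((m : ℕ) : ℝ) ≤ a := Nat.floor_le ha.le
      have hac : a ≤ (m : ℝ) + 1 := (Nat.lt_floor_add_one a).le
      have hcb : (m : ℝ) + 1 ≤ b := by
        have : (((m + (n + 1) : ℕ)) : ℝ) ≤ b := by rw [← heq]; exact Nat.floor_le hb.le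
        push_cast at this; linarith
      have hc : (0 : ℝ) < (m : ℝ) + 1 := by positivity
      rw [dG_split ha hac hcb, dG_cell m ha hac h1 le_rfl]
      have hcast : ((m : ℝ) + 1) = ((m + 1 : ℕ) : ℝ) := by push_cast; ring
      have hfl : ⌊(m : ℝ) + 1⌋₊ = m + 1 := by rw [hcast, Nat.floor_natCast]
      have ih := dG_eq_psiH_sub n hc hcb (by rw [hfl]; omega)
      rw [ih, hcast, psiH_natCast (Nat.succ_pos m), harmR_succ]
      unfold psiH
      push_cast
      field_simp
      ring

/-- `δ(a,b) = Ψ(a) − Ψ(b)` for all positive `a`, `b` (by symmetry). -/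
theorem dG_eq_psiH_sub' {a b : ℝ} (ha : 0 < a) (hb : 0 < b) : dG a b = psiH a - psiH b := by
  rcases le_total a b with h | h
  · exact dG_eq_psiH_sub ⌊b⌋₊ ha h (Nat.le_add_left _ _)
  · rw [dG_symm ha hb, dG_eq_psiH_sub ⌊a⌋₊ hb h (Nat.le_add_left _ _)]; ring

/-- **The hinge form of the `J`-term**: `jT x U = x log x + Ψ(U)·x − q_U(x)` for `x ≥ 0`, `U > 0`. -/
theorem jT_eq_hinge {x U : ℝ} (hx : 0 ≤ x) (hU : 0 < U) : jT x U = mulLog x + psiH U * x - qH U x := by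
  rcases hx.eq_or_lt with h | hx0
  · subst h
    simp [jT, mulLog, qH]
  · rw [jT_tail x hU, dG_eq_psiH_sub' hU (mul_pos hU hx0)]
    unfold mulLog qH psiH
    have hUx : U * x ≠ 0 := (mul_pos hU hx0).ne'
    field_simp
    ring

/-! ### The hinge sum and its secant enclosure -/

/-- Below the break the hinge is affine: `k + 1 ≤ U x` ⇒ `hinge = x/(k+1) − 1/U`. -/
theorem hinge_of_le {U x : ℝ} (hU : 0 < U) {k : ℕ} (h : (k : ℝ) + 1 ≤ U * x) :
    hinge U x k = x / ((k : ℝ) + 1) - 1 / U := by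
  unfold hinge
  apply max_eq_left
  rw [sub_nonneg, div_le_div_iff₀ hU (by positivity)]
  linarith

/-- Above the break the hinge vanishes: `U x ≤ k + 1` ⇒ `hinge = 0`. -/
theorem hinge_of_ge {U x : ℝ} (hU : 0 < U) {k : ℕ} (h : U * x ≤ (k : ℝ) + 1) : hinge U x k = 0 := by
  unfold hinge
  apply max_eq_right
  rw [sub_nonpos, div_le_div_iff₀ (by positivity) hU]
  linarith

/-- Hinges are non-decreasing and `1/(k+1)`-Lipschitz: `0 ≤ h(y) − h(x) ≤ (y − x)/(k+1)` for `x ≤ y`. -/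
theorem hinge_sub_mem {U x y : ℝ} (hxy : x ≤ y) (k : ℕ) :
    0 ≤ hinge U y k - hinge U x k ∧ hinge U y k - hinge U x k ≤ (y - x) / ((k : ℝ) + 1) := by
  unfold hinge
  have hk : (0 : ℝ) < (k : ℝ) + 1 := by positivity
  have hmono : x / ((k : ℝ) + 1) ≤ y / ((k : ℝ) + 1) := div_le_div_of_nonneg_right hxy hk.le
  have e : (y - x) / ((k : ℝ) + 1) = y / ((k : ℝ) + 1) - x / ((k : ℝ) + 1) := by ring
  rw [e]
  constructor
  · have : max (x / ((k : ℝ) + 1) - 1 / U) 0 ≤ max (y / ((k : ℝ) + 1) - 1 / U) 0 :=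
      max_le_max (by linarith) le_rfl
    linarith
  · rcases le_total (x / ((k : ℝ) + 1) - 1 / U) 0 with h1 | h1
    · rw [max_eq_right h1]
      rcases le_total (y / ((k : ℝ) + 1) - 1 / U) 0 with h2 | h2
      · rw [max_eq_right h2]; linarith
      · rw [max_eq_left h2]; linarith
    · rw [max_eq_left h1, max_eq_left (h1.trans (by linarith))]; linarith

/-- **`q_U(x) = Σ_{k<K} (x/(k+1) − 1/U)₊`** for any `K ≥ ⌊Ux⌋` (`x ≥ 0`, `U > 0`). -/
theorem qH_eq_sum_hinge {U x : ℝ} (hU : 0 < U) (hx : 0 ≤ x) {K : ℕ} (hK : ⌊U * x⌋₊ ≤ K) :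
    qH U x = ∑ k ∈ Finset.range K, hinge U x k := by
  set N := ⌊U * x⌋₊ with hN
  have hUx : 0 ≤ U * x := mul_nonneg hU.le hx
  rw [← Finset.sum_range_add_sum_Ico _ hK]
  have h2 : ∑ k ∈ Finset.Ico N K, hinge U x k = 0 := by
    refine Finset.sum_eq_zero fun k hk => hinge_of_ge hU ?_
    have hk' : N ≤ k := (Finset.mem_Ico.mp hk).1
    have : U * x < (N : ℝ) + 1 := Nat.lt_floor_add_one _
    have : (N : ℝ) ≤ k := by exact_mod_cast hk'
    linarith
  have h1 : ∑ k ∈ Finset.range N, hinge U x k = ∑ k ∈ Finset.range N, (x / ((k : ℝ) + 1) - 1 / U) := by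
    refine Finset.sum_congr rfl fun k hk => hinge_of_le hU ?_
    have hk' : k + 1 ≤ N := Finset.mem_range.mp hk
    have : ((k + 1 : ℕ) : ℝ) ≤ (N : ℝ) := by exact_mod_cast hk'
    have hNle : (N : ℝ) ≤ U * x := Nat.floor_le hUx
    push_cast at this; linarith
  rw [h2, add_zero, h1, Finset.sum_sub_distrib, Finset.sum_const, Finset.card_range]
  unfold qH harmR
  rw [Finset.mul_sum]
  simp only [nsmul_eq_mul, mul_one_div]
  rfl

/-- **Lower secant bound**: for `0 ≤ lo ≤ x ≤ y`, `(y − x)·H_⌊U·lo⌋ ≤ q_U(y) − q_U(x)`. -/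
theorem le_qH_sub {U lo x y : ℝ} (hU : 0 < U) (hlo : 0 ≤ lo) (hx : lo ≤ x) (hxy : x ≤ y) :
    (y - x) * harmR ⌊U * lo⌋₊ ≤ qH U y - qH U x := by
  have hx0 : 0 ≤ x := hlo.trans hx
  have hy0 : 0 ≤ y := hx0.trans hxy
  set K := ⌊U * y⌋₊ with hK
  have hKx : ⌊U * x⌋₊ ≤ K := Nat.floor_le_floor (mul_le_mul_of_nonneg_left hxy hU.le)
  have hKlo : ⌊U * lo⌋₊ ≤ K := Nat.floor_le_floor (mul_le_mul_of_nonneg_left (hx.trans hxy) hU.le)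
  rw [qH_eq_sum_hinge hU hy0 le_rfl, qH_eq_sum_hinge hU hx0 hKx, ← Finset.sum_sub_distrib,
    ← Finset.sum_range_add_sum_Ico _ hKlo]
  have hA : (y - x) * harmR ⌊U * lo⌋₊ = ∑ k ∈ Finset.range ⌊U * lo⌋₊, (hinge U y k - hinge U x k) := by
    unfold harmR
    rw [Finset.mul_sum]
    refine Finset.sum_congr rfl fun k hk => ?_
    have hk' : k + 1 ≤ ⌊U * lo⌋₊ := Finset.mem_range.mp hk
    have h1 : ((k + 1 : ℕ) : ℝ) ≤ (⌊U * lo⌋₊ : ℝ) := by exact_mod_cast hk'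
    have h2 : (⌊U * lo⌋₊ : ℝ) ≤ U * lo := Nat.floor_le (mul_nonneg hU.le hlo)
    push_cast at h1
    have hkx : (k : ℝ) + 1 ≤ U * x := by nlinarith
    have hky : (k : ℝ) + 1 ≤ U * y := by nlinarith
    rw [hinge_of_le hU hkx, hinge_of_le hU hky]
    ring
  rw [hA]
  have hB : 0 ≤ ∑ k ∈ Finset.Ico ⌊U * lo⌋₊ K, (hinge U y k - hinge U x k) :=
    Finset.sum_nonneg fun k _ => (hinge_sub_mem hxy k).1
  linarith

/-- **Upper secant bound**: for `0 ≤ x ≤ y ≤ hi`, `q_U(y) − q_U(x) ≤ (y − x)·H_⌊U·hi⌋`. -/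
theorem qH_sub_le {U x y hi : ℝ} (hU : 0 < U) (hx0 : 0 ≤ x) (hxy : x ≤ y) (hy : y ≤ hi) :
    qH U y - qH U x ≤ (y - x) * harmR ⌊U * hi⌋₊ := by
  have hy0 : 0 ≤ y := hx0.trans hxy
  set K := ⌊U * hi⌋₊ with hK
  have hKy : ⌊U * y⌋₊ ≤ K := Nat.floor_le_floor (mul_le_mul_of_nonneg_left hy hU.le)
  have hKx : ⌊U * x⌋₊ ≤ K := (Nat.floor_le_floor (mul_le_mul_of_nonneg_left hxy hU.le)).trans hKy
  rw [qH_eq_sum_hinge hU hy0 hKy, qH_eq_sum_hinge hU hx0 hKx, ← Finset.sum_sub_distrib]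
  unfold harmR
  rw [Finset.mul_sum]
  refine Finset.sum_le_sum fun k _ => ?_
  rw [mul_one_div]
  exact (hinge_sub_mem hxy k).2

/-- **The secant enclosure of the hinge sum**: for `0 ≤ lo ≤ x ≤ y ≤ hi` (`U > 0`),
`(y − x)·H_⌊U·lo⌋ ≤ q_U(y) − q_U(x) ≤ (y − x)·H_⌊U·hi⌋`. -/
theorem qH_secant {U lo x y hi : ℝ} (hU : 0 < U) (hlo : 0 ≤ lo) (hx : lo ≤ x) (hxy : x ≤ y) (hy : y ≤ hi) :
    (y - x) * harmR ⌊U * lo⌋₊ ≤ qH U y - qH U x ∧ qH U y - qH U x ≤ (y - x) * harmR ⌊U * hi⌋₊ :=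
  ⟨le_qH_sub hU hlo hx hxy, qH_sub_le hU (hlo.trans hx) hxy hy⟩

/-! ### `x log x` -/

/-- **Secant enclosure of `x log x`**: for `0 < lo ≤ x ≤ y ≤ hi`,
`(y − x)(1 + log lo) ≤ y log y − x log x ≤ (y − x)(1 + log hi)` (mean value theorem; `(x log x)' = log x + 1`). -/
theorem mulLog_secant {lo x y hi : ℝ} (hlo : 0 < lo) (hx : lo ≤ x) (hxy : x ≤ y) (hy : y ≤ hi) :
    (y - x) * (1 + Real.log lo) ≤ mulLog y - mulLog x ∧ mulLog y - mulLog x ≤ (y - x) * (1 + Real.log hi) := by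
  rcases hxy.eq_or_lt with h | hlt
  · subst h; simp
  · have hx0 : 0 < x := hlo.trans_le hx
    have hcont : ContinuousOn (fun z : ℝ => z * Real.log z) (Icc x y) :=
      Real.continuous_mul_log.continuousOn
    have hder : ∀ z ∈ Ioo x y, HasDerivAt (fun z : ℝ => z * Real.log z) (Real.log z + 1) z :=
      fun z hz => Real.hasDerivAt_mul_log (hx0.trans hz.1).ne'
    obtain ⟨ξ, hξ, hslope⟩ := exists_hasDerivAt_eq_slope (fun z : ℝ => z * Real.log z)
      (fun z => Real.log z + 1) hlt hcont hder
    have hξ0 : 0 < ξ := hx0.trans hξ.1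
    have hpos : 0 < y - x := sub_pos.mpr hlt
    have e : mulLog y - mulLog x = (y - x) * (Real.log ξ + 1) := by
      unfold mulLog; rw [hslope]; field_simp
    rw [e]
    have l1 : Real.log lo ≤ Real.log ξ := Real.log_le_log hlo (hx.trans hξ.1.le)
    have l2 : Real.log ξ ≤ Real.log hi := Real.log_le_log hξ0 (hξ.2.le.trans hy)
    constructor <;> nlinarith


end LemmaFWinBox

end Summit.KontsevichZagierPeriods.Zeta5Search.Barrier.ConeGamma
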